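import Summits.QuantumFields.YangMills.Theses.ContractibleFibre
import Literature.Barriers.QuantumFields.DiscreteSubgroupFreezing

/-!
# `FibreToTorus` — negative lemma: the separation bound `2n < L` of the hypothesis is load-bearing
# (with it deleted the free-tube family is unsatisfiable and the crux closes vacuously)

Support file for crux `stmt-QuantumFields-16244`
(`Summit.QuantumFields.YangMills.Theses.ContractibleFibre.FibreToTorus`, route `ContractibleFibre`, rank 4),
extracted from the standing disprover's work file `Cruxes/FibreToTorus/Disproof.lean` §4 (cycle 1).  Bodies inline
(no auxiliary `def … : Prop`); tree objects only.  Dual of `Negative/TimeBoundLoadBearing.lean` (the clause `n ≤ S`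
of the CONCLUSION): here the clause `2 * n < L` of the HYPOTHESIS.

* `abs_re_trace_le` — `|Re tr r.ρ(g)| ≤ N` (unitary entries have norm `≤ 1`).
* `var_ratio_pos` — positive variance in ratio-of-integrals form: for a continuous action on a compact
  configuration space whose probability reference measure charges open sets, a continuous observable taking two
  values has `Ex (F·F) − (Ex F)² > 0`, `Ex H = (∫ H e^{act} dν)/(∫ e^{act} dν)`.
* `allSep_bound_false` — abstract core: an all-separations clustering bound `|Ex (F·F∘σ_n) − Ex F·Ex (F∘σ_n)| ≤ C e^{-mn}`,
  `m > 0`, together with shifts `σ_{kL}` fixing `F` (periodicity), forces `Var F ≤ 0` — contradiction.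
* `tube_allSep_false` — the route file's free-tube predicate with `2 * n < L →` DELETED is false for every
  non-trivial compact `G`, faithful `r`, width `M`, coupling `β`, slab width `w`, floor `Lmin`, constant `C`, as soon
  as `m > 0`: on the tube `L := max Lmin 1` the time shift by `kL` is the identity, and the normalised one-link
  character `Re tr r.ρ(U_ℓ)/N` (a width-`0` slab observable with `|F| ≤ 1`) has positive variance under the tube
  Gibbs measure (positive continuous density against the product of Haar measures) and separates `U ≡ 1` from
  `U ≡ g₀ ≠ 1` by faithfulness.
* `fibreToTorus_allSep_vacuous` — hence the crux with `2 * n < L →` deleted from its hypothesis holds VACUOUSLY: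
  the clause `2n < L` (the short way round the time circle of the tube) is what keeps the hypothesis of
  `FibreToTorus` satisfiable at all; together with `Negative/RateLoadBearing.lean` (rate `0 < m`) it locates the
  content of the hypothesis in "one `m > 0`, one `C`, all `L ≥ Lmin(M)`, separations up to `L/2`".

Nothing here asserts a statement of the route (negative/support lane, `--supports stmt-QuantumFields-16244`). [folklore]
-/

noncomputable section

namespace Summit.QuantumFields.YangMills.Theorems.FibreToTorus.Negative

open MeasureTheory Filter Topology
open Literature.MathematicalPhysics.QuantumFieldTheory

section Abstract

variable {G : Type} [Group G] [TopologicalSpace G]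

/-- `|Re tr r.ρ(g)| ≤ N` for a unitary matrix representation (entries of a unitary matrix have norm `≤ 1`). [folklore] -/
theorem abs_re_trace_le (r : LatticeRep G) (g : G) : |((r.ρ g).trace).re| ≤ r.N := by
  have h1 : |((r.ρ g).trace).re| ≤ ‖(r.ρ g).trace‖ := Complex.abs_re_le_norm _
  have h2 : ‖(r.ρ g).trace‖ ≤ ∑ i, ‖(r.ρ g) i i‖ := by
    rw [Matrix.trace]; exact norm_sum_le _ _
  have h3 : ∑ i, ‖(r.ρ g) i i‖ ≤ ∑ _i : Fin r.N, (1 : ℝ) :=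
    Finset.sum_le_sum fun i _ => entry_norm_bound_of_unitary (r.mem_unitary g) i i
  simp only [Finset.sum_const, Finset.card_univ, Fintype.card_fin, nsmul_eq_mul, mul_one] at h3
  linarith


/-- **Positive variance in ratio form.** For a continuous `act` on a compact configuration space whose probability
reference measure `ν` charges open sets, a continuous observable `F` taking two different values has
`Ex (F·F) − (Ex F)² > 0`, `Ex H = (∫ H e^{act} dν)/(∫ e^{act} dν)`. [folklore] -/
theorem var_ratio_pos {Ω : Type*} [MeasurableSpace Ω] [TopologicalSpace Ω] [OpensMeasurableSpace Ω]
    [CompactSpace Ω] (ν : Measure Ω) [IsProbabilityMeasure ν] [ν.IsOpenPosMeasure] {act : Ω → ℝ}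
    (hact : Continuous act) {F : Ω → ℝ} (hF : Continuous F) {U₀ V₀ : Ω} (hUV : F U₀ ≠ F V₀) :
    0 < (∫ U, F U * F U * Real.exp (act U) ∂ν) / (∫ U, Real.exp (act U) ∂ν) -
      (∫ U, F U * Real.exp (act U) ∂ν) / (∫ U, Real.exp (act U) ∂ν) *
        ((∫ U, F U * Real.exp (act U) ∂ν) / (∫ U, Real.exp (act U) ∂ν)) := by
  have hw_cont : Continuous fun U => Real.exp (act U) := Real.continuous_exp.comp hact
  have hcs : ∀ f : Ω → ℝ, HasCompactSupport f := fun f => (isClosed_tsupport f).isCompact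
  have hw_int : Integrable (fun U => Real.exp (act U)) ν := hw_cont.integrable_of_hasCompactSupport (hcs _)
  have hZ : 0 < ∫ U, Real.exp (act U) ∂ν := integral_exp_pos hw_int
  have hFw : Integrable (fun U => F U * Real.exp (act U)) ν :=
    (hF.mul hw_cont).integrable_of_hasCompactSupport (hcs _)
  have hFFw : Integrable (fun U => F U * F U * Real.exp (act U)) ν :=
    ((hF.mul hF).mul hw_cont).integrable_of_hasCompactSupport (hcs _)
  set Z := ∫ U, Real.exp (act U) ∂ν with hZdef
  set c := (∫ U, F U * Real.exp (act U) ∂ν) / Z with hcdef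
  -- `∫ (F - c)² e^{act} > 0`
  have hg : Continuous fun U => (F U - c) ^ 2 * Real.exp (act U) := by fun_prop
  have hx : ∃ X, (F X - c) ^ 2 * Real.exp (act X) ≠ 0 := by
    by_contra hall
    push Not at hall
    have hU := hall U₀
    have hV := hall V₀
    rw [mul_eq_zero, sq_eq_zero_iff, sub_eq_zero] at hU hV
    rcases hU with hU | hU
    · rcases hV with hV | hV
      · exact hUV (hU.trans hV.symm)
      · exact (Real.exp_pos _).ne' hV
    · exact (Real.exp_pos _).ne' hU
  obtain ⟨X, hX⟩ := hx
  have hpos : 0 < ∫ U, (F U - c) ^ 2 * Real.exp (act U) ∂ν :=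
    hg.integral_pos_of_hasCompactSupport_nonneg_nonzero (hcs _)
      (fun U => mul_nonneg (sq_nonneg _) (Real.exp_pos _).le) hX
  have hexpand : ∫ U, (F U - c) ^ 2 * Real.exp (act U) ∂ν =
      (∫ U, F U * F U * Real.exp (act U) ∂ν - 2 * c * ∫ U, F U * Real.exp (act U) ∂ν) + c ^ 2 * Z := by
    have h1 : (fun U => (F U - c) ^ 2 * Real.exp (act U)) =
        fun U => (F U * F U * Real.exp (act U) - 2 * c * (F U * Real.exp (act U))) + c ^ 2 * Real.exp (act U) := by
      funext U; ring
    rw [h1, integral_add (f := fun U => F U * F U * Real.exp (act U) - 2 * c * (F U * Real.exp (act U)))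
        (g := fun U => c ^ 2 * Real.exp (act U)) (hFFw.sub (hFw.const_mul _)) (hw_int.const_mul _),
      integral_sub (f := fun U => F U * F U * Real.exp (act U)) (g := fun U => 2 * c * (F U * Real.exp (act U)))
        hFFw (hFw.const_mul _), integral_const_mul, integral_const_mul]
  have hcZ : ∫ U, F U * Real.exp (act U) ∂ν = c * Z := by
    rw [hcdef, div_mul_cancel₀ _ hZ.ne']
  rw [hexpand, hcZ] at hpos
  have hA : c * c * Z < ∫ U, F U * F U * Real.exp (act U) ∂ν := by nlinarith
  rw [sub_pos, lt_div_iff₀ hZ]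
  exact hA


/-- **Periodic copies kill an all-separations clustering bound (abstract form).**  If a ratio-of-integrals
Gibbs average clusters `F` against its shifts `F ∘ σ_n` at rate `m > 0` for ALL `n`, while the shifts by multiples
of some `L ≥ 1` fix `F` (time-periodicity of the tube), then `F` has vanishing variance — impossible for a
continuous `F` taking two values when `ν` charges open sets (`var_ratio_pos`). [folklore] -/
theorem allSep_bound_false {Ω : Type*} [MeasurableSpace Ω] [TopologicalSpace Ω] [OpensMeasurableSpace Ω]
    [CompactSpace Ω] (ν : Measure Ω) [IsProbabilityMeasure ν] [ν.IsOpenPosMeasure] {act : Ω → ℝ}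
    {F : Ω → ℝ} {σ : ℕ → Ω → Ω} {C m : ℝ} {L : ℕ}
    (key : ∀ n : ℕ, |(∫ U, F U * F (σ n U) * Real.exp (act U) ∂ν) / (∫ U, Real.exp (act U) ∂ν) -
        (∫ U, F U * Real.exp (act U) ∂ν) / (∫ U, Real.exp (act U) ∂ν) *
          ((∫ U, F (σ n U) * Real.exp (act U) ∂ν) / (∫ U, Real.exp (act U) ∂ν))| ≤ C * Real.exp (-(m * n)))
    (hσ : ∀ (k : ℕ) (U : Ω), F (σ (k * L) U) = F U) (hm : 0 < m) (hL : 1 ≤ L)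
    (hact : Continuous act) (hF : Continuous F) {U₀ V₀ : Ω} (hUV : F U₀ ≠ F V₀) : False := by
  -- the bound along `n = kL` tends to `0`
  have hlim : Tendsto (fun k : ℕ => C * Real.exp (-(m * ((k * L : ℕ) : ℝ)))) atTop (𝓝 0) := by
    have h1 : Tendsto (fun k : ℕ => m * ((k * L : ℕ) : ℝ)) atTop atTop := by
      have : (fun k : ℕ => m * ((k * L : ℕ) : ℝ)) = fun k : ℕ => m * (L : ℝ) * (k : ℝ) := by
        funext k; push_cast; ring
      rw [this]
      exact Tendsto.const_mul_atTop (mul_pos hm (by exact_mod_cast hL)) tendsto_natCast_atTop_atTop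
    have hexp := Real.tendsto_exp_atBot.comp (tendsto_neg_atTop_atBot.comp h1)
    simpa using hexp.const_mul C
  have hX : (∫ U, F U * F U * Real.exp (act U) ∂ν) / (∫ U, Real.exp (act U) ∂ν) -
      (∫ U, F U * Real.exp (act U) ∂ν) / (∫ U, Real.exp (act U) ∂ν) *
        ((∫ U, F U * Real.exp (act U) ∂ν) / (∫ U, Real.exp (act U) ∂ν)) ≤ 0 :=
    ge_of_tendsto' hlim fun k => by
      have hk := key (k * L)
      simp only [hσ k] at hk
      exact (le_abs_self _).trans hk
  exact (not_lt.2 hX) (var_ratio_pos ν hact hF hUV)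


end Abstract

/-- **The separation bound `2n < L` is load-bearing for the satisfiability of the hypothesis.**  With it deleted,
the tube predicate is FALSE for every non-trivial compact `G`, every faithful `r`, every width, coupling, slab
width, volume floor and constant, as soon as the rate is positive: the tube is periodic in time with period `L`,
so at separations `n = kL` the "two" observables coincide (`σ_{kL} = id`) and the bound `C e^{-mkL} → 0` forces
the variance of the normalised one-link character `Re tr r.ρ(U_ℓ)/N` to vanish — while it is positive (the tube
Gibbs weight is a positive continuous density against a product of Haar measures, which charges open sets, and the
character separates `U ≡ 1` from `U ≡ g₀ ≠ 1` by faithfulness).  So without `2n < L` the crux would close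
VACUOUSLY (its hypothesis unsatisfiable), cf. §2 for the dual clause `n ≤ S` of the conclusion. [folklore] -/
theorem tube_allSep_false (G : Type) [Group G] [TopologicalSpace G] [IsTopologicalGroup G] [CompactSpace G]
    [MeasurableSpace G] [BorelSpace G] [Nontrivial G] (r : LatticeRep G) (M : ℕ) (β : ℝ) {m : ℝ} (hm : 0 < m)
    (C : ℝ) (w Lmin : ℕ) :
    let TubeAllSep := fun (M : ℕ) (β m C : ℝ) (w Lmin : ℕ) => ∀ (L : ℕ) [NeZero L], Lmin ≤ L → let St := ZMod L × ZMod L × Fin (M + 1) × Fin (M + 1); let Cfg := St × Fin 4 → G; let ν : MeasureTheory.Measure Cfg := MeasureTheory.Measure.pi fun _ => haarProbability G; let sh : St → Fin 4 → St := fun x μ => ![(x.1 + 1, x.2.1, x.2.2.1, x.2.2.2), (x.1, x.2.1 + 1, x.2.2.1, x.2.2.2), (x.1, x.2.1, x.2.2.1 + 1, x.2.2.2), (x.1, x.2.1, x.2.2.1, x.2.2.2 + 1)] μ; let ins : St → Fin 4 → Fin 4 → ℝ := fun x μ κ => if ((μ = 2 ∨ κ = 2) → (x.2.2.1 : ℕ)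 < M) ∧ ((μ = 3 ∨ κ = 3) → (x.2.2.2 : ℕ) < M) then 1 else 0; let pl : Cfg → St → Fin 4 → Fin 4 → G := fun U x μ κ => U (x, μ) * U (sh x μ, κ) * (U (sh x κ, μ))⁻¹ * (U (x, κ))⁻¹; let act : Cfg → ℝ := fun U => β * ∑ x : St, ∑ q : {q : Fin 4 × Fin 4 // q.1 < q.2}, ins x q.1.1 q.1.2 * (r.ρ (pl U x q.1.1 q.1.2)).trace.re; let wgt : Cfg → ℝ := fun U => Real.exp (act U); let Ex : (Cfg → ℝ) → ℝ := fun F => (∫ U, F U * wgt U ∂ν) / (∫ U, wgt U ∂ν); let σ : ℕ → Cfg → Cfg := fun n U p => U ((p.1.1 + n, p.1.2), p.2); ∀ c : ZMod L, let Loc := fun F : Cfg → ℝ => Measurable F ∧ (∀ U, |F U| ≤ 1) ∧ ∀ U U', (∀ p : St × Fin 4, (p.1.1 - c).val ≤ w → U p = U' p) → F U = F U'; ∀ F₁ F₂ : Cfg → ℝ, Loc F₁ → Loc F₂ → ∀ n : ℕ, |Ex (fun U => F₁ U * F₂ (σ n U)) - Ex F₁ * Ex (fun U => F₂ (σ n U))|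 ≤ C * Real.exp (-(m * n)); ¬ TubeAllSep M β m C w Lmin := by
  intro TubeAllSep
  haveI : SecondCountableTopology G :=
    (r.continuous.isClosedEmbedding r.injective).isEmbedding.secondCountableTopology
  haveI : (haarProbability G).IsOpenPosMeasure := by unfold haarProbability; infer_instance
  have hρ : Continuous fun g : G => ((r.ρ g).trace).re :=
    Complex.continuous_re.comp r.continuous.matrix_trace
  obtain ⟨g₀, hg₀⟩ := exists_ne (1 : G)
  -- the representation space is non-zero and the character sees `g₀ ≠ 1`
  have hN : (r.N : ℝ) ≠ 0 := by
    intro h0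
    have hN0 : r.N = 0 := by exact_mod_cast h0
    apply hg₀
    apply r.injective
    have : Subsingleton (Matrix (Fin r.N) (Fin r.N) ℂ) := by rw [hN0]; infer_instance
    exact Subsingleton.elim _ _
  have hNpos : (0 : ℝ) < r.N := lt_of_le_of_ne (Nat.cast_nonneg _) (Ne.symm hN)
  have htr : ((r.ρ g₀).trace).re ≠ r.N := fun h =>
    hg₀ (r.injective (by rw [Literature.Barriers.QuantumFields.eq_one_of_re_trace_eq (r.mem_unitary g₀) h, map_one]))
  intro h
  set L := max Lmin 1 with hLdef
  have hL1 : 1 ≤ L := le_max_right _ _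
  haveI : NeZero L := ⟨by omega⟩
  have hL := h L (le_max_left _ _)
  dsimp only [TubeAllSep] at hL
  -- the observable: normalised one-link character at the link based at the origin, direction 0
  obtain ⟨F, hFdef⟩ : ∃ F : (((ZMod L × ZMod L × Fin (M + 1) × Fin (M + 1)) × Fin 4 → G) → ℝ),
      F = fun U => ((r.ρ (U ((0, 0, 0, 0), 0))).trace).re / r.N := ⟨_, rfl⟩
  have hFcont : Continuous F := by
    rw [hFdef]
    exact (hρ.comp (continuous_apply _)).div_const _
  have hF1 : ∀ U, |F U| ≤ 1 := fun U => by
    rw [hFdef]; dsimp only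
    rw [abs_div, Nat.abs_cast, div_le_one hNpos]
    exact abs_re_trace_le r _
  have hLoc : Measurable F ∧ (∀ U, |F U| ≤ 1) ∧
      ∀ U U' : (ZMod L × ZMod L × Fin (M + 1) × Fin (M + 1)) × Fin 4 → G,
        (∀ p : (ZMod L × ZMod L × Fin (M + 1) × Fin (M + 1)) × Fin 4, (p.1.1 - 0).val ≤ w → U p = U' p) →
          F U = F U' :=
    ⟨hFcont.measurable, hF1, fun U U' hUU' => by rw [hFdef]; dsimp only; rw [hUU' ((0, 0, 0, 0), 0) (by simp)]⟩
  have key := hL 0 F F hLoc hLoc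
  -- at separations `kL` the shifted observable is the observable
  have hσ : ∀ (k : ℕ) (U : (ZMod L × ZMod L × Fin (M + 1) × Fin (M + 1)) × Fin 4 → G),
      F (fun p => U ((p.1.1 + ((k * L : ℕ) : ZMod L), p.1.2), p.2)) = F U := by
    intro k U
    rw [hFdef]; dsimp only
    rw [Nat.cast_mul, ZMod.natCast_self, mul_zero, add_zero]
  -- two configurations the observable separates
  have hUV : F (fun _ => 1) ≠ F (fun _ => g₀) := by
    rw [hFdef]; dsimp only
    rw [map_one, Matrix.trace_one, Fintype.card_fin, Complex.natCast_re, div_self hN]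
    intro h1
    exact htr ((div_eq_one_iff_eq hN).1 h1.symm)
  exact allSep_bound_false (MeasureTheory.Measure.pi fun _ => haarProbability G) key hσ hm hL1
    (by
      refine continuous_const.mul (continuous_finsetSum _ fun x _ =>
        continuous_finsetSum _ fun q _ => continuous_const.mul (hρ.comp ?_))
      fun_prop)
    hFcont hUV


/-- Sanity (kernel-checked): the crux with its hypothesis written exactly as below but WITH `2 * n < L →` is
`FibreToTorus` by `Iff.rfl` — so the theorem below mutates one clause and nothing else. -/
example : Summit.QuantumFields.YangMills.Theses.ContractibleFibre.FibreToTorus ↔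
    (∀ (G : Type) [Group G] [TopologicalSpace G] [IsTopologicalGroup G] [CompactSpace G], IsCompactSimpleLieGroup G → letI : MeasurableSpace G := borel G; haveI : BorelSpace G := ⟨rfl⟩; ∀ r : LatticeRep G, let Tube := fun (M : ℕ) (β m C : ℝ) (w Lmin : ℕ) => ∀ (L : ℕ) [NeZero L], Lmin ≤ L → let St := ZMod L × ZMod L × Fin (M + 1) × Fin (M + 1); let Cfg := St × Fin 4 → G; let ν : MeasureTheory.Measure Cfg := MeasureTheory.Measure.pi fun _ => haarProbability G; let sh : St → Fin 4 → St := fun x μ => ![(x.1 + 1, x.2.1, x.2.2.1, x.2.2.2), (x.1, x.2.1 + 1, x.2.2.1, x.2.2.2), (x.1, x.2.1, x.2.2.1 + 1, x.2.2.2), (x.1, x.2.1, x.2.2.1, x.2.2.2 + 1)] μ; let ins : St → Fin 4 → Fin 4 → ℝ := fun x μ κ => if ((μ = 2 ∨ κ = 2) → (x.2.2.1 : ℕ) < M) ∧ ((μ = 3 ∨ κ = 3) → (x.2.2.2 : ℕ) < M) then 1 else 0; let pl : Cfg → St → Fin 4 → Fin 4 → G := fun U x μ κ => U (x, μ) * U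 (sh x μ, κ) * (U (sh x κ, μ))⁻¹ * (U (x, κ))⁻¹; let act : Cfg → ℝ := fun U => β * ∑ x : St, ∑ q : {q : Fin 4 × Fin 4 // q.1 < q.2}, ins x q.1.1 q.1.2 * (r.ρ (pl U x q.1.1 q.1.2)).trace.re; let wgt : Cfg → ℝ := fun U => Real.exp (act U); let Ex : (Cfg → ℝ) → ℝ := fun F => (∫ U, F U * wgt U ∂ν) / (∫ U, wgt U ∂ν); let σ : ℕ → Cfg → Cfg := fun n U p => U ((p.1.1 + n, p.1.2), p.2); ∀ c : ZMod L, let Loc := fun F : Cfg → ℝ => Measurable F ∧ (∀ U, |F U| ≤ 1) ∧ ∀ U U', (∀ p : St × Fin 4, (p.1.1 - c).val ≤ w → U p = U' p) → F U = F U'; ∀ F₁ F₂ : Cfg → ℝ, Loc F₁ → Loc F₂ → ∀ n : ℕ, 2 * n < L → |Ex (fun U => F₁ U * F₂ (σ n U)) - Ex F₁ * Ex (fun U => F₂ (σ n U))| ≤ C * Real.exp (-(m * n)); (∃ β₁ : ℝ, ∀ β : ℝ, β₁ ≤ β → ∃ m : ℝ, 0 < m ∧ ∀ w : ℕ, ∃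 C : ℝ, ∀ M : ℕ, ∃ Lmin : ℕ, Tube M β m C w Lmin) → ∃ β₀ : ℝ, ∀ β : ℝ, β₀ ≤ β → ∃ m : ℝ, 0 < m ∧ ∃ S₁ : ℕ, ∀ A B : YMSpecies G, ∃ C : ℝ, ∀ S n : ℕ, S₁ ≤ S → n ≤ S → |latticeConnectedCorr r.ρ β (2 * S + 1) A.F B.F n| ≤ C * Real.exp (-(m * n))) :=
  Iff.rfl

/-- **Without `2n < L` the crux closes vacuously.**  `FibreToTorus` with `2 * n < L →` deleted from its hypothesis
(conclusion verbatim) HOLDS — for nothing: by `tube_allSep_false` no compact simple `G` (non-trivial, being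
non-abelian) and faithful `r` carry the mutated family.  So the separation bound is load-bearing for the
hypothesis having any model. [folklore] -/
theorem fibreToTorus_allSep_vacuous :
    ∀ (G : Type) [Group G] [TopologicalSpace G] [IsTopologicalGroup G] [CompactSpace G], IsCompactSimpleLieGroup G → letI : MeasurableSpace G := borel G; haveI : BorelSpace G := ⟨rfl⟩; ∀ r : LatticeRep G, let TubeAllSep := fun (M : ℕ) (β m C : ℝ) (w Lmin : ℕ) => ∀ (L : ℕ) [NeZero L], Lmin ≤ L → let St := ZMod L × ZMod L × Fin (M + 1) × Fin (M + 1); let Cfg := St × Fin 4 → G; let ν : MeasureTheory.Measure Cfg := MeasureTheory.Measure.pi fun _ => haarProbability G; let sh : St → Fin 4 → St := fun x μ => ![(x.1 + 1, x.2.1, x.2.2.1, x.2.2.2), (x.1, x.2.1 + 1, x.2.2.1, x.2.2.2), (x.1, x.2.1, x.2.2.1 + 1, x.2.2.2), (x.1, x.2.1, x.2.2.1, x.2.2.2 + 1)] μ; let ins : St → Fin 4 → Fin 4 → ℝ := fun x μ κ => if ((μ = 2 ∨ κ = 2) → (x.2.2.1 : ℕ) < M) ∧ ((μ = 3 ∨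 κ = 3) → (x.2.2.2 : ℕ) < M) then 1 else 0; let pl : Cfg → St → Fin 4 → Fin 4 → G := fun U x μ κ => U (x, μ) * U (sh x μ, κ) * (U (sh x κ, μ))⁻¹ * (U (x, κ))⁻¹; let act : Cfg → ℝ := fun U => β * ∑ x : St, ∑ q : {q : Fin 4 × Fin 4 // q.1 < q.2}, ins x q.1.1 q.1.2 * (r.ρ (pl U x q.1.1 q.1.2)).trace.re; let wgt : Cfg → ℝ := fun U => Real.exp (act U); let Ex : (Cfg → ℝ) → ℝ := fun F => (∫ U, F U * wgt U ∂ν) / (∫ U, wgt U ∂ν); let σ : ℕ → Cfg → Cfg := fun n U p => U ((p.1.1 + n, p.1.2), p.2); ∀ c : ZMod L, let Loc := fun F : Cfg → ℝ => Measurable F ∧ (∀ U, |F U| ≤ 1) ∧ ∀ U U', (∀ p : St × Fin 4, (p.1.1 - c).val ≤ w → U p = U' p) → F U = F U'; ∀ F₁ F₂ : Cfg → ℝ, Loc F₁ → Loc F₂ → ∀ n : ℕ, |Ex (fun U => F₁ U * F₂ (σ n U)) - Ex F₁ * Ex (fun U => F₂ (σ n U))| ≤ C * Real.exp (-(m * n));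 (∃ β₁ : ℝ, ∀ β : ℝ, β₁ ≤ β → ∃ m : ℝ, 0 < m ∧ ∀ w : ℕ, ∃ C : ℝ, ∀ M : ℕ, ∃ Lmin : ℕ, TubeAllSep M β m C w Lmin) → ∃ β₀ : ℝ, ∀ β : ℝ, β₀ ≤ β → ∃ m : ℝ, 0 < m ∧ ∃ S₁ : ℕ, ∀ A B : YMSpecies G, ∃ C : ℝ, ∀ S n : ℕ, S₁ ≤ S → n ≤ S → |latticeConnectedCorr r.ρ β (2 * S + 1) A.F B.F n| ≤ C * Real.exp (-(m * n)) := by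
  intro G _ _ _ _ hG
  letI : MeasurableSpace G := borel G
  haveI : BorelSpace G := ⟨rfl⟩
  intro r TubeAllSep hfam
  exfalso
  obtain ⟨a, b, hab⟩ := hG.1.2.1
  haveI : Nontrivial G := ⟨⟨a * b, b * a, hab⟩⟩
  obtain ⟨β₁, h⟩ := hfam
  obtain ⟨m, hm, h⟩ := h β₁ le_rfl
  obtain ⟨C, h⟩ := h 0
  obtain ⟨Lmin, h⟩ := h 0
  exact tube_allSep_false G r 0 β₁ hm C 0 Lmin h

end Summit.QuantumFields.YangMills.Theorems.FibreToTorus.Negative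

end
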